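import Literature.MathematicalPhysics.QuantumFieldTheory.ConstructiveQFTWave0Proofs
import Literature.MathematicalPhysics.QuantumLattice.GrassmannIntegral
import HarnessLib

/-!
# C-periodic (C⋆) boundary conditions and twisted quark fields on the lattice torus

Kronfeld–Wiese **C-periodic boundary conditions**: fields are periodic up to charge conjugation in
the chosen directions, `U_μ(x + L k̂) = U_μ(x)^*`, `ψ(x + L k̂) = C⁻¹ψ̄ᵀ(x)`, `ψ̄(x + L k̂) = −ψᵀ(x) C`
(Kronfeld–Wiese 1991; Lucini–Patella–Ramos–Tantalo 2016, §2 and §6: lattice links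
`U(x + L̂_k, ρ) = U(x, ρ)^*`, gauge transformations `Λ(x + L̂_k) = Λ(x)^*`). As for the 't Hooft
twist (sibling file `TwistedBoundaryConditions.lean`) we work on the FUNDAMENTAL DOMAIN: the
configuration space is the periodic one, `GaugeConfig d L G`, and the boundary condition sits in the
couplings — whenever a plaquette, a gauge transformation or a hopping term fetches a variable across
the boundary of a C-direction `μ ∈ S` (from a site with `x_μ = L − 1` to `x + μ̂`), the fetched group
element is replaced by its image under the "charge conjugation" `σ : G →* G` (complex conjugation
`suConj` for `SU(N)`; any endomorphism is allowed in the definitions, the physics wants an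
involutive automorphism), and the fetched fermion doublet is flipped by `K = diag(1, −1)`.

Contents.
* Gauge sector (any group `G`, any `σ : G →* G`, any set `S` of C-directions; `S = ∅` is the
  periodic theory, `cPlaquetteHolonomy_empty`, `cWilsonAction_empty`): `cBdry`, `cPlaquetteHolonomy`,
  `cGaugeTransform`, `cWilsonAction`, `cWilsonWeight`, `cPartitionFunction`, `cWilsonMeasure`,
  `cWilsonExpectation`; PROVED gauge covariance/invariance `cPlaquetteHolonomy_cGaugeTransform`,
  `cWilsonAction_cGaugeTransform`, `measurePreserving_cGaugeTransform`,
  `cWilsonMeasure_map_cGaugeTransform` ("the proposed action is invariant under local gauge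
  transformations … `Λ(x + L̂_k) = Λ(x)^*`", Lucini et al. §6); the complex-conjugation
  endomorphism `suConj` of `SU(N)` (an involution, `suConj_suConj`).
* C-periodic Wilson quarks (Lucini–Patella–Ramos–Tantalo 2016, App. D "Anatomy of the sign
  problem", valid "for a general non-abelian gauge theory"): with `ψ_± = (ψ ± C⁻¹ψ̄ᵀ)/√2` and the
  doublet `η = (ψ₊, −iψ₋)`, C-periodicity becomes `η(x + L̂_k) = K η(x)`, `K = diag(1, −1)`; using
  `C⁻¹ D[V]ᵀ C = D[V^*]` the action is `ψ̄ D[V] ψ = −½ ηᵀ C D[𝒥(V)] η` with the real form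
  `𝒥(V) = 1₂ ⊗ Re V + J ⊗ Im V` of the gauge representation (`realify`), and the fermionic integral is
  the Pfaffian `Pf_K(C D_𝒥)`. We define the charge-conjugation matrix `chargeConj = γ₁γ₃` for the
  tree's chiral `euclideanGamma` (PROVED: `C γ_μᵀ = −γ_μ C`, `Cᵀ = −C`, `C² = −1`), the doublet
  operator `cstarWilsonDirac S ρ U m r` (the tree's `wilsonDirac` with colour matrices `𝒥(ρ(U))`
  and the flip `K` inserted on hops that cross a C-boundary), and the fermionic Boltzmann factor and
  its Berezin integral `cstarFermionPfaffian` through the tree's Grassmann calculus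
  (`pairingQuadratic`, `grassmannExp`, `berezin`) — PROVED in the sequel
  `CPeriodicFermionPfaffian.lean`, with NO orientation sign: `= Pf` of the antisymmetric part of
  `M = (C ⊗ 1) D_𝒥` in general (`cstarFermionPfaffian_eq_pfaffian`), `C D_𝒥` IS antisymmetric for
  unitary `ρ` (`transpose_spinChargeConj_mul_cstarWilsonDirac`), hence `= Pf(M) = Pf_K(C D_𝒥)`
  (`cstarFermionPfaffian_eq_pfaffian_of_unitary`); the one-species Gaussian Berezin integral
  `∫ dθ exp(Σ_{i<j} Aᵢⱼθᵢθⱼ) = Pf A` is `GrassmannGaussianPfaffian.lean`.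
* Quarks with an 't Hooft twist, `N_f = N` (Parisi): fundamental fields are single valued on the
  twisted torus only if flavour ("smell") indices rotate with the opposite twist,
  `ψ^a_α(n + L ν̂) = e^{iθ_ν} Ω_ν^{ab} ψ^b_β(n) (Ω_ν†)_{βα}` (Lin–Ogawa–Ramos 2015, §2.1). After the
  colour twist matrices are absorbed into the boundary links (the periodic-variables form of the
  sibling file) only the flavour rotation survives on boundary-crossing hops:
  `flavourTwistedWilsonDirac F ρ U m r`, flavour matrices `F_ν` (e.g. `e^{iθ_ν} Ω̄_ν`) on the
  forward hops across `x_ν = L − 1` and `F_ν⁻¹` on the backward ones; `F ≡ 1` is the tree's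
  flavour-diagonal Wilson–Dirac operator (`flavourTwistedWilsonDirac_one`).

Scope remarks (what the sources say and this file does NOT claim). (i) For PURE `SU(N)` gauge
theory C-periodic boundary conditions remove the `Z_N` electric-flux sectors but NOT the torons:
"the minima of the potential energy are gauge-equivalent to real, constant, abelian fields"
(the `so(N)` components stay periodic), the vacuum valley being the orbifold
`[0, 4π)^d/(ℤ₂ × ℤ₂)` for `SU(3)` (Kronfeld–Wiese 1993, §2); for `SU(2)` C-periodic and periodic
boundary conditions are gauge equivalent (ibid.). Isolated classical vacua are a feature of the
't Hooft twist (irreducible twists) and of compact `U(1)` (Lucini et al. §6 and App. C "Classical vacua of compact QED"), not of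
C-periodic `SU(N)`. (ii) Not here: gauge covariance of the Dirac operators, the
orbifold/doubled-lattice implementation, translations by `L` as charge conjugation on observables,
flavour and baryon-number violation by the boundary, thermal (anti)periodicity in time (direction
`0 ∉ S` is the user's choice). The `γ₅`-hermiticity of `D_𝒥` and the reality and sign of the
Pfaffian (Lucini et al. App. D, second half) are PROVED in the sequel `CPeriodicPfaffianSign.lean`
(`conjTranspose_cstarWilsonDirac`, `cstarFermionPfaffian_im_eq_zero`,
`cstarFermionPfaffian_eq_prod_eigenvalues`, `cstarFermionPfaffian_sign_of_no_negative_eigenvalue`).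

## References

* A. S. Kronfeld, U.-J. Wiese, *SU(N) gauge theories with C-periodic boundary conditions (I).
  Topological structure*, Nucl. Phys. B 357 (1991) 521–533. [KronfeldWiese1991] (not held;
  definitions taken from the two open sources below, which restate them)
* A. S. Kronfeld, U.-J. Wiese, *… (II). Small-volume dynamics*, Nucl. Phys. B 401 (1993) 190,
  hep-lat/9210008, §1–§2. [KronfeldWiese1993]
* B. Lucini, A. Patella, A. Ramos, N. Tantalo, *Charged hadrons in local finite-volume QED+QCD with
  C⋆ boundary conditions*, JHEP 02 (2016) 076, arXiv:1509.01636, §2, §6, App. D ("Anatomy of the sign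
  problem"; appendix letters as in the JHEP version: A–D = arXiv sections 8–11). [LuciniEtAl2016]
* C.-J. D. Lin, K. Ogawa, A. Ramos, *The Yang–Mills gradient flow and SU(3) gauge theory with 12
  massless fundamental fermions in a colour-twisted box*, JHEP 12 (2015) 103, §2.1. [LinOgawaRamos2015]
-/

noncomputable section

open MeasureTheory
open scoped Kronecker Matrix

namespace Literature.MathematicalPhysics.QuantumLattice

open QuantumFieldTheory

variable {d L N : ℕ} {G : Type*} [Group G]

/-! ## C-periodic gauge fields on the fundamental domain -/

section Gauge

variable (S : Finset (Fin d)) (σ : G →* G)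

/-- The **boundary map** for a fetch from the site `x` across direction `μ`: the charge conjugation
`σ` if `μ` is a C-direction (`μ ∈ S`) and the hop `x → x + μ̂` wraps around the torus
(`x_μ = L − 1`), the identity otherwise ("`U(x + L̂_k, ρ) = U(x, ρ)^*`"). [cite: LuciniEtAl2016, §6 (link boundary condition)] -/
def cBdry (x : Site d L) (μ : Fin d) : G →* G :=
  if μ ∈ S ∧ x μ = -1 then σ else MonoidHom.id G

/-- Shifting the base site in a direction `μ ≠ ν` does not change the boundary map of direction `ν`. [folklore] -/
theorem cBdry_shift_of_ne (x : Site d L) {μ ν : Fin d} (h : μ ≠ ν) :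
    cBdry S σ (x.shift μ) ν = cBdry (L := L) S σ x ν := by
  simp only [cBdry, WilsonRP.shift_apply_of_ne x h.symm]

/-- Boundary maps commute with each other (each is `σ` or the identity). [folklore] -/
theorem cBdry_comm (x y : Site d L) (μ ν : Fin d) (a : G) :
    cBdry S σ x μ (cBdry S σ y ν a) = cBdry S σ y ν (cBdry S σ x μ a) := by
  unfold cBdry; split_ifs <;> rfl

/-- With no C-direction every boundary map is the identity. [folklore] -/
@[simp] theorem cBdry_empty (x : Site d L) (μ : Fin d) : cBdry (∅ : Finset (Fin d)) σ x μ = MonoidHom.id G := by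
  simp [cBdry]

/-- The **C-periodic plaquette holonomy** on the fundamental domain:
`U(x,μ) · [U(x+μ̂,ν)] · [U(x+ν̂,μ)]⁻¹ · U(x,ν)⁻¹` where a link fetched across a C-boundary is
replaced by its charge conjugate (`[U(x+μ̂,ν)] = σ(U(x+μ̂ mod L, ν))` if `μ ∈ S`, `x_μ = L−1`). [cite: LuciniEtAl2016, §6 (plaquette and action)] -/
def cPlaquetteHolonomy (U : GaugeConfig d L G) (x : Site d L) (μ ν : Fin d) : G :=
  U (x, μ) * cBdry S σ x μ (U (x.shift μ, ν)) * (cBdry S σ x ν (U (x.shift ν, μ)))⁻¹ * (U (x, ν))⁻¹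

/-- With no C-direction the C-periodic holonomy is the periodic plaquette holonomy. [folklore] -/
@[simp] theorem cPlaquetteHolonomy_empty (U : GaugeConfig d L G) (x : Site d L) (μ ν : Fin d) :
    cPlaquetteHolonomy (∅ : Finset (Fin d)) σ U x μ ν = plaquetteHolonomy U x μ ν := by
  simp [cPlaquetteHolonomy, plaquetteHolonomy]

/-- **C-periodic gauge transformations** by `g : Λ → G` on the fundamental domain, extended across
the C-boundaries by `g(x + L k̂) = σ(g(x))`: `U(x,μ) ↦ g(x) U(x,μ) [g(x+μ̂)]⁻¹` with
`[g(x+μ̂)] = σ(g(x+μ̂ mod L))` on boundary-crossing links of C-directions ("`Λ(x + L̂_k) = Λ(x)^*`"). [cite: LuciniEtAl2016, §6 (gauge transformations)] -/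
def cGaugeTransform (g : Site d L → G) (U : GaugeConfig d L G) : GaugeConfig d L G :=
  fun e => g e.1 * U e * (cBdry S σ e.1 e.2 (g (e.1.shift e.2)))⁻¹

/-- **Gauge covariance of the C-periodic holonomy**: for `μ ≠ ν`,
`P_x(U^g) = g(x) P_x(U) g(x)⁻¹` — the conjugated factors fetched across the boundary cancel because
`σ` is multiplicative and the boundary maps of the two directions commute. [cite: LuciniEtAl2016, §6 ("the proposed action is invariant under local gauge transformations")] -/
theorem cPlaquetteHolonomy_cGaugeTransform (g : Site d L → G) (U : GaugeConfig d L G) (x : Site d L)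
    {μ ν : Fin d} (hμν : μ ≠ ν) :
    cPlaquetteHolonomy S σ (cGaugeTransform S σ g U) x μ ν =
      g x * cPlaquetteHolonomy S σ U x μ ν * (g x)⁻¹ := by
  simp only [cPlaquetteHolonomy, cGaugeTransform, map_mul, map_inv, cBdry_shift_of_ne S σ x hμν,
    cBdry_shift_of_ne S σ x hμν.symm, WilsonRP.shift_comm x ν μ,
    cBdry_comm S σ x x ν μ (g ((x.shift μ).shift ν)), mul_inv_rev, inv_inv]
  group

variable (ρ : G →* Matrix (Fin N) (Fin N) ℂ)

/-- The **C-periodic Wilson action** `∑ₚ (N − Re tr ρ(P_p))` over the plaquettes of the fundamental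
domain with the C-periodic holonomy (`S_γ` of Lucini et al. §6 up to normalisation, for a
general gauge group). [cite: LuciniEtAl2016, §6 (action S_γ)] -/
def cWilsonAction [NeZero L] (U : GaugeConfig d L G) : ℝ :=
  ∑ p : Plaquette d L, ((N : ℝ) - (ρ (cPlaquetteHolonomy S σ U p.1 p.2.1.1 p.2.1.2)).trace.re)

/-- With no C-direction the C-periodic Wilson action is Wilson's. [folklore] -/
theorem cWilsonAction_empty [NeZero L] (U : GaugeConfig d L G) :
    cWilsonAction (∅ : Finset (Fin d)) σ ρ U = wilsonAction ρ U := by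
  simp [cWilsonAction, wilsonAction]

/-- **Gauge invariance of the C-periodic Wilson action** under C-periodic gauge transformations. [cite: LuciniEtAl2016, §6 (gauge transformations)] -/
theorem cWilsonAction_cGaugeTransform [NeZero L] (g : Site d L → G) (U : GaugeConfig d L G) :
    cWilsonAction S σ ρ (cGaugeTransform S σ g U) = cWilsonAction S σ ρ U := by
  have htr : ∀ a b : G, (ρ (a * b * a⁻¹)).trace = (ρ b).trace := fun a b => by
    rw [map_mul, map_mul, Matrix.trace_mul_cycle, ← map_mul, inv_mul_cancel, map_one, one_mul]
  refine Finset.sum_congr rfl fun p _ => ?_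
  rw [cPlaquetteHolonomy_cGaugeTransform S σ g U p.1 (ne_of_lt p.2.2), htr]

variable [TopologicalSpace G] [IsTopologicalGroup G] [CompactSpace G] [MeasurableSpace G]
  [BorelSpace G]

/-- The un-normalised C-periodic Wilson weight `exp(−β S_C(U)) ∏ₑ dU_e`. [cite: LuciniEtAl2016, §6 (action S_γ)] -/
def cWilsonWeight [NeZero L] (β : ℝ) : Measure (GaugeConfig d L G) :=
  (Measure.pi fun _ : Edge d L => haarProbability G).withDensity
    fun U => ENNReal.ofReal (Real.exp (-β * cWilsonAction S σ ρ U))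

/-- The C-periodic partition function. [folklore] -/
def cPartitionFunction [NeZero L] (β : ℝ) : ENNReal :=
  cWilsonWeight (d := d) (L := L) S σ ρ β Set.univ

/-- **The C-periodic Wilson measure** `Z⁻¹ exp(−β S_C(U)) ∏ₑ dU_e`: lattice gauge theory with
C-periodic boundary conditions in the directions `S` (periodic in the others) on the fundamental
domain `(ℤ/L)^d`. [cite: KronfeldWiese1993, §1] [cite: LuciniEtAl2016, §6] -/
def cWilsonMeasure [NeZero L] (β : ℝ) : Measure (GaugeConfig d L G) :=
  (cPartitionFunction (d := d) (L := L) S σ ρ β)⁻¹ • cWilsonWeight S σ ρ β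

/-- Expectations in the C-periodic finite-volume theory (junk `0` if not integrable). [folklore] -/
def cWilsonExpectation [NeZero L] {V : Type*} [NormedAddCommGroup V] [NormedSpace ℝ V] (β : ℝ)
    (F : GaugeConfig d L G → V) : V :=
  ∫ U, F U ∂(cWilsonMeasure S σ ρ β)

omit [TopologicalSpace G] [IsTopologicalGroup G] [CompactSpace G] [MeasurableSpace G]
  [BorelSpace G] in
/-- C-periodic gauge transformations compose contravariantly with pointwise inverses:
`(U^{g})^{g⁻¹} = U`. [folklore] -/
theorem cGaugeTransform_inv_cGaugeTransform (g : Site d L → G) (U : GaugeConfig d L G) :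
    cGaugeTransform S σ g⁻¹ (cGaugeTransform S σ g U) = U := by
  funext e
  simp [cGaugeTransform, mul_assoc]

/-- **C-periodic gauge transformations preserve the product Haar measure**: link by link they are
two-sided translations `U_e ↦ g(x) U_e h_e⁻¹` by constants. [folklore] -/
theorem measurePreserving_cGaugeTransform [NeZero L] (γ : Site d L → G) :
    MeasurePreserving (cGaugeTransform S σ γ : GaugeConfig d L G → GaugeConfig d L G)
      (Measure.pi fun _ : Edge d L => haarProbability G)
      (Measure.pi fun _ : Edge d L => haarProbability G) :=
  measurePreserving_pi
    (f := fun (e : Edge d L) (x : G) => γ e.1 * x * (cBdry S σ e.1 e.2 (γ (e.1.shift e.2)))⁻¹)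
    (fun _ : Edge d L => haarProbability G) (fun _ : Edge d L => haarProbability G)
    fun e => WilsonGauge.measurePreserving_mul_mul (γ e.1) (cBdry S σ e.1 e.2 (γ (e.1.shift e.2)))⁻¹

/-- The C-periodic gauge transformation by `g` as a measurable equivalence (inverse: the one by
`g⁻¹`). [folklore] -/
def cGaugeEquiv [NeZero L] (g : Site d L → G) : GaugeConfig d L G ≃ᵐ GaugeConfig d L G where
  toFun := cGaugeTransform S σ g
  invFun := cGaugeTransform S σ g⁻¹
  left_inv U := cGaugeTransform_inv_cGaugeTransform S σ g U
  right_inv U := by simpa using cGaugeTransform_inv_cGaugeTransform S σ g⁻¹ U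
  measurable_toFun := (measurePreserving_cGaugeTransform S σ g).measurable
  measurable_invFun := (measurePreserving_cGaugeTransform S σ g⁻¹).measurable

/-- **Gauge invariance of the C-periodic Wilson measure**: the push-forward of `μ_{C,β}` under every
C-periodic gauge transformation is `μ_{C,β}` (invariant product Haar measure, invariant density,
unchanged normalisation). [cite: LuciniEtAl2016, §6] -/
theorem cWilsonMeasure_map_cGaugeTransform [NeZero L] (β : ℝ) (g : Site d L → G) :
    (cWilsonMeasure S σ ρ β).map (cGaugeTransform S σ g) = cWilsonMeasure (d := d) (L := L) S σ ρ β := by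
  simp only [cWilsonMeasure, Measure.map_smul, cWilsonWeight]
  congr 1
  exact WilsonGauge.withDensity_map_equiv_of_invariant _ (cGaugeEquiv S σ g) _
    (measurePreserving_cGaugeTransform S σ g).map_eq
    fun U => by simp only [cGaugeEquiv, MeasurableEquiv.coe_mk, Equiv.coe_fn_mk,
      cWilsonAction_cGaugeTransform]

end Gauge

/-! ## Charge conjugation of `SU(N)` link variables -/

section SUConj

variable (N)

/-- Complex conjugation preserves `SU(N)`: `Ū` is unitary and `det Ū = conj(det U) = 1`. [folklore] -/
theorem conj_mem_specialUnitaryGroup {U : Matrix (Fin N) (Fin N) ℂ}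
    (hU : U ∈ Matrix.specialUnitaryGroup (Fin N) ℂ) :
    U.map (starRingEnd ℂ) ∈ Matrix.specialUnitaryGroup (Fin N) ℂ := by
  rw [Matrix.mem_specialUnitaryGroup_iff, Matrix.mem_unitaryGroup_iff] at hU ⊢
  obtain ⟨h1, h2⟩ := hU
  refine ⟨?_, ?_⟩
  · have hs : star (U.map (starRingEnd ℂ)) = (star U).map (starRingEnd ℂ) := by
      rw [Matrix.star_eq_conjTranspose, Matrix.star_eq_conjTranspose,
        Matrix.conjTranspose_map (starRingEnd ℂ) (fun x => by simp)]
    rw [hs, ← Matrix.map_mul, h1, Matrix.map_one _ (map_zero _) (map_one _)]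
  · rw [← RingHom.mapMatrix_apply, ← RingHom.map_det, h2, map_one]

/-- **Charge conjugation of link variables**, `U ↦ U^* = Ū` (entrywise complex conjugate), as a
group endomorphism of `SU(N)` — the `σ` of the C-periodic boundary condition
`U(x + L̂_k, ρ) = U(x, ρ)^*` for QCD. [cite: LuciniEtAl2016, §6 (link boundary condition)] [cite: KronfeldWiese1993, §1] -/
def suConj : Matrix.specialUnitaryGroup (Fin N) ℂ →* Matrix.specialUnitaryGroup (Fin N) ℂ where
  toFun U := ⟨(U : Matrix (Fin N) (Fin N) ℂ).map (starRingEnd ℂ), conj_mem_specialUnitaryGroup N U.2⟩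
  map_one' := Subtype.ext (Matrix.map_one _ (map_zero _) (map_one _))
  map_mul' _ _ := Subtype.ext Matrix.map_mul

/-- The matrix of `suConj N U` is the entrywise conjugate of `U`. [folklore] -/
@[simp] theorem coe_suConj (U : Matrix.specialUnitaryGroup (Fin N) ℂ) :
    ((suConj N U : Matrix.specialUnitaryGroup (Fin N) ℂ) : Matrix (Fin N) (Fin N) ℂ) =
      (U : Matrix (Fin N) (Fin N) ℂ).map (starRingEnd ℂ) := rfl

/-- Charge conjugation is an involution. [folklore] -/
@[simp] theorem suConj_suConj (U : Matrix.specialUnitaryGroup (Fin N) ℂ) : suConj N (suConj N U) = U := by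
  apply Subtype.ext
  simp [Matrix.map_map, Function.comp_def]

end SUConj

/-! ## C-periodic Wilson quarks: charge-conjugation matrix, real form, doublet operator -/

section Fermions

/-- The **charge-conjugation matrix** `C = γ₁ γ₃` for the tree's chiral Euclidean gamma matrices
(`euclideanGamma`: `γ_k = σʸ ⊗ σᵏ`, `γ₃ = σˣ ⊗ 1`): the two gamma matrices that are symmetric in this
basis. It satisfies `C⁻¹ γ_μ C = −γ_μᵀ`, `Cᵀ = −C`, `C† = C⁻¹` (`= −C`), as required of "any
invertible matrix `C` with `C⁻¹γ_μC = −γ_μᵀ`". [cite: LuciniEtAl2016, §2 (the charge conjugation matrix)] -/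
def chargeConj : Matrix (Fin 4) (Fin 4) ℂ :=
  euclideanGamma 1 * euclideanGamma 3

/-- `C² = −1` (so `C⁻¹ = −C = Cᵀ = C†`). [cite: LuciniEtAl2016, §2 (the charge conjugation matrix)] -/
theorem chargeConj_mul_chargeConj : chargeConj * chargeConj = -1 := by
  ext i j
  fin_cases i <;> fin_cases j <;>
    simp [chargeConj, euclideanGamma, QuantumLattice.spinHalfPauli, Matrix.kroneckerMap_apply,
      finProdFinEquiv, Fin.divNat, Fin.modNat, Matrix.mul_apply, Fin.sum_univ_four]

/-- `Cᵀ = −C`. [cite: LuciniEtAl2016, §2 (the charge conjugation matrix)] -/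
theorem chargeConj_transpose : chargeConjᵀ = -chargeConj := by
  ext i j
  fin_cases i <;> fin_cases j <;>
    simp [chargeConj, euclideanGamma, QuantumLattice.spinHalfPauli, Matrix.kroneckerMap_apply,
      finProdFinEquiv, Fin.divNat, Fin.modNat, Matrix.mul_apply, Fin.sum_univ_four]

/-- The defining relation `C⁻¹ γ_μ C = −γ_μᵀ`, in the inverse-free form `γ_μ C = −C γ_μᵀ`. [cite: LuciniEtAl2016, §2 (the charge conjugation matrix)] -/
theorem euclideanGamma_mul_chargeConj (μ : Fin 4) :
    euclideanGamma μ * chargeConj = -(chargeConj * (euclideanGamma μ)ᵀ) := by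
  fin_cases μ <;>
  · ext i j
    fin_cases i <;> fin_cases j <;>
      simp [chargeConj, euclideanGamma, QuantumLattice.spinHalfPauli, Matrix.kroneckerMap_apply,
        finProdFinEquiv, Fin.divNat, Fin.modNat, Matrix.mul_apply, Fin.sum_univ_four]

/-- `J = [[0, −1], [1, 0]]`, the real form of `i`. [cite: LuciniEtAl2016, App. D (real form 𝒥(V))] -/
def realJ : Matrix (Fin 2) (Fin 2) ℂ := !![0, -1; 1, 0]

/-- `K = diag(1, −1)`, the boundary flip of the doublet `η = (ψ₊, −iψ₋)`:
`η(x + L̂_k) = K η(x)`. [cite: LuciniEtAl2016, App. D (K boundary conditions)] -/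
def kFlip : Matrix (Fin 2) (Fin 2) ℂ := !![1, 0; 0, -1]

/-- The **real form** `𝒥(V) = 1₂ ⊗ Re V + J ⊗ Im V` of a complex matrix, acting on the doublet ⊗
colour space ("`𝒥(V)` defines a representation of the gauge group, unitarily equivalent to the
representation defined by `V`"). [cite: LuciniEtAl2016, App. D (real form 𝒥(V))] -/
def realify {n : Type*} (M : Matrix n n ℂ) : Matrix (Fin 2 × n) (Fin 2 × n) ℂ :=
  (1 : Matrix (Fin 2) (Fin 2) ℂ) ⊗ₖ M.map (fun w => ((w.re : ℝ) : ℂ)) +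
    realJ ⊗ₖ M.map (fun w => ((w.im : ℝ) : ℂ))

/-- Conjugating the matrix flips the sign of the `J` part: `𝒥(V̄) = (K ⊗ 1) 𝒥(V) (K ⊗ 1)`, which is
why a translation by `L` (charge conjugation of the links) acts on the doublet by `K`. [cite: LuciniEtAl2016, App. D (K boundary conditions; real form)] -/
theorem realify_map_conj {n : Type*} [Fintype n] [DecidableEq n] (M : Matrix n n ℂ) :
    realify (M.map (starRingEnd ℂ)) =
      kFlip ⊗ₖ (1 : Matrix n n ℂ) * realify M * kFlip ⊗ₖ (1 : Matrix n n ℂ) := by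
  have hKK : kFlip * kFlip = (1 : Matrix (Fin 2) (Fin 2) ℂ) := by
    ext i j; fin_cases i <;> fin_cases j <;> simp [kFlip]
  have hKJ : kFlip * realJ * kFlip = -realJ := by
    ext i j; fin_cases i <;> fin_cases j <;> simp [kFlip, realJ, Matrix.mul_apply]
  have hre : (M.map (starRingEnd ℂ)).map (fun w => ((w.re : ℝ) : ℂ)) =
      M.map (fun w => ((w.re : ℝ) : ℂ)) := by
    ext a b; simp
  have him : (M.map (starRingEnd ℂ)).map (fun w => ((w.im : ℝ) : ℂ)) =
      (-1 : ℂ) • M.map (fun w => ((w.im : ℝ) : ℂ)) := by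
    ext a b; simp
  rw [realify, realify, hre, him]
  simp only [Matrix.mul_add, Matrix.add_mul, ← Matrix.mul_kronecker_mul, Matrix.mul_one,
    Matrix.one_mul, hKK, hKJ, Matrix.kronecker_smul]
  rw [← neg_one_smul ℂ realJ, Matrix.smul_kronecker]

variable (S : Finset (Fin 4)) (ρ : G →* Matrix (Fin N) (Fin N) ℂ)

/-- The doublet ⊗ colour matrix inserted on a hop from `x` across direction `μ`: the flip `K ⊗ 1`
if the hop crosses a C-boundary, `1` otherwise. [cite: LuciniEtAl2016, App. D (K boundary conditions)] -/
def kAt (x : Site 4 L) (μ : Fin 4) : Matrix (Fin 2 × Fin N) (Fin 2 × Fin N) ℂ :=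
  if μ ∈ S ∧ x μ = -1 then kFlip ⊗ₖ (1 : Matrix (Fin N) (Fin N) ℂ) else 1

/-- **The C-periodic (C⋆) Wilson–Dirac operator** `D_𝒥` on doublet fields `η = (ψ₊, −iψ₋)` of the
fundamental domain, index `site × (doublet × colour) × spin`: the Wilson–Dirac operator (the tree's
`wilsonDirac`, Wilson parameter `r`, bare mass `m`) in the real form `𝒥(ρ(U))` of the gauge field,
with the flip `K` inserted on every hop that crosses the boundary in a C-direction `μ ∈ S` (`K`
boundary conditions `η(x + L̂_k) = K η(x)`); with it the C-periodic quark action is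
`ψ̄ D[U] ψ = −½ ηᵀ (C ⊗ 1) D_𝒥 η` and the fermionic integral is `Pf_K(C D_𝒥)`. [cite: LuciniEtAl2016, App. D (K boundary conditions; S_F = −½ηᵀCD_𝒥η; Pfaffian)] -/
def cstarWilsonDirac (U : GaugeConfig 4 L G) (m r : ℝ) :
    Matrix (Site 4 L × (Fin 2 × Fin N) × Fin 4) (Site 4 L × (Fin 2 × Fin N) × Fin 4) ℂ :=
  Matrix.of fun p q =>
    (if p = q then ((m + 4 * r : ℝ) : ℂ) else 0) -
      (1 / 2 : ℂ) * ∑ μ : Fin 4,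
        ((if q.1 = QuantumFieldTheory.Site.shift p.1 μ then
            ((r : ℂ) • (1 : Matrix (Fin 4) (Fin 4) ℂ) - euclideanGamma μ) p.2.2 q.2.2 *
              (realify (ρ (U (p.1, μ))) * kAt (N := N) S p.1 μ) p.2.1 q.2.1 else 0) +
          (if p.1 = QuantumFieldTheory.Site.shift q.1 μ then
            ((r : ℂ) • (1 : Matrix (Fin 4) (Fin 4) ℂ) + euclideanGamma μ) p.2.2 q.2.2 *
              (kAt (N := N) S q.1 μ * realify (ρ ((U (q.1, μ))⁻¹))) p.2.1 q.2.1 else 0))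

/-- The symmetric-free **pairing form** `Σᵢⱼ Bᵢⱼ θᵢ θⱼ` of a matrix `B` in ONE species of
Grassmann generators (only the antisymmetric part of `B` contributes); its exponential integrates
to the Pfaffian of `2·B_antisym = B - Bᵀ` with no orientation sign:
`berezin (grassmannExp (pairingQuadratic B)) = pfaffian (B - Bᵀ)` (PROVED,
`berezin_grassmannExp_pairingQuadratic` in the sequel `CPeriodicFermionPfaffian.lean`; Wegner 2016
(5.4), Zinn-Justin 2021 (1.77)). [folklore] -/
def pairingQuadratic {R : Type*} [CommRing R] {ι : Type*} [Fintype ι] [DecidableEq ι]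
    (B : Matrix ι ι R) : GrassmannAlgebra R ι :=
  ∑ i, ∑ j, B i j • (GrassmannAlgebra.gen R i * GrassmannAlgebra.gen R j)

variable (L N) in
/-- A linear enumeration of the doublet quark variables of one flavour on the torus of side `L`
(the tree's Berezin integral needs a linear order). [folklore] -/
abbrev CstarIdx [NeZero L] : Type := Fin (Fintype.card (Site 4 L × (Fin 2 × Fin N) × Fin 4))

/-- The fixed enumeration of doublet quark variables. [folklore] -/
def cstarIdxEquiv [NeZero L] : Site 4 L × (Fin 2 × Fin N) × Fin 4 ≃ CstarIdx L N :=
  Fintype.equivFin _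

/-- `C ⊗ 1`: the charge-conjugation matrix on the spin index of doublet quark variables. [folklore] -/
def spinChargeConj [NeZero L] :
    Matrix (Site 4 L × (Fin 2 × Fin N) × Fin 4) (Site 4 L × (Fin 2 × Fin N) × Fin 4) ℂ :=
  (1 : Matrix (Site 4 L) (Site 4 L) ℂ) ⊗ₖ ((1 : Matrix (Fin 2 × Fin N) (Fin 2 × Fin N) ℂ) ⊗ₖ chargeConj)

/-- The **C-periodic fermionic Boltzmann factor** of one Wilson flavour,
`exp(½ ηᵀ (C ⊗ 1) D_𝒥 η) = e^{−S_F}`, as an element of the Grassmann algebra of the doublet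
variables. [cite: LuciniEtAl2016, App. D (S_F = −½ηᵀCD_𝒥η; Pfaffian)] -/
def cstarFermiBoltzmann [NeZero L] (U : GaugeConfig 4 L G) (m r : ℝ) : GrassmannAlgebra ℂ (CstarIdx L N) :=
  grassmannExp (pairingQuadratic ((1 / 2 : ℂ) •
    Matrix.reindex cstarIdxEquiv cstarIdxEquiv (spinChargeConj * cstarWilsonDirac S ρ U m r)))

/-- The **C-periodic fermionic integral** of one Wilson flavour, `∫ 𝒟η e^{½ ηᵀ C D_𝒥 η}` — the
Pfaffian `Pf_K(C D_𝒥)` of Lucini et al.: PROVED equal to `pfaffian (½ • (M - Mᵀ))` for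
`M = (C ⊗ 1) D_𝒥` re-indexed along `cstarIdxEquiv` (`cstarFermionPfaffian_eq_pfaffian`), and to
`pfaffian M` for unitary `ρ`, where `Mᵀ = -M` (`cstarFermionPfaffian_eq_pfaffian_of_unitary`,
`transpose_spinChargeConj_mul_cstarWilsonDirac`, sequel `CPeriodicFermionPfaffian.lean`), with no
orientation sign; the reality of the Pfaffian by `γ₅`-hermiticity (ibid.) is `cstarFermionPfaffian_im_eq_zero` and
its sign anatomy (`= Pf(C ⊗ 1) · ∏_{Im λ = 0} λ^{m} · ∏_{Im λ > 0} |λ^{m}|²`, "negative only if `D_𝒥` has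
negative eigenvalues") `cstarFermionPfaffian_eq_prod_eigenvalues` /
`cstarFermionPfaffian_sign_of_no_negative_eigenvalue` in the sequel `CPeriodicPfaffianSign.lean`. For
`N_f` flavours of masses `m_f` the fermionic weight is the product over `f`. [cite: LuciniEtAl2016, App. D (Pfaffian Pf_K(CD_𝒥), reality)] -/
def cstarFermionPfaffian [NeZero L] (U : GaugeConfig 4 L G) (m r : ℝ) : ℂ :=
  GrassmannAlgebra.berezin ℂ (CstarIdx L N) (cstarFermiBoltzmann S ρ U m r)

end Fermions

/-! ## Quarks on the 't Hooft-twisted torus: flavour-twisted Wilson–Dirac operator (`N_f = N`) -/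

section FlavourTwist

variable {Nf : ℕ} (F : Fin 4 → Matrix (Fin Nf) (Fin Nf) ℂ) (ρ : G →* Matrix (Fin N) (Fin N) ℂ)

/-- The flavour matrix on a FORWARD hop from `x` across direction `μ`: `F_μ` if the hop wraps
around the torus (`x_μ = L − 1`), `1` otherwise. [cite: LinOgawaRamos2015, §2.1 (fermion boundary condition)] -/
def flavourHop (x : Site 4 L) (μ : Fin 4) : Matrix (Fin Nf) (Fin Nf) ℂ :=
  if x μ = -1 then F μ else 1

/-- The flavour matrix on a BACKWARD hop into `x + μ̂` across direction `μ`: `F_μ⁻¹` if the hop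
wraps, `1` otherwise (matrix inverse; `= F_μ†` for unitary flavour twists). [cite: LinOgawaRamos2015, §2.1] -/
def flavourHopInv (x : Site 4 L) (μ : Fin 4) : Matrix (Fin Nf) (Fin Nf) ℂ :=
  if x μ = -1 then (F μ)⁻¹ else 1

/-- **The flavour-twisted Wilson–Dirac operator** of `N_f` flavours (index flavour × (site × colour
× spin), the tree's `QuarkVar` order) in periodic link variables `U` on the torus `(ℤ/L)^4`: the
tree's `wilsonDirac` flavour by flavour, except that a hop crossing the boundary `x_μ = L − 1`
rotates the flavour index by `F_μ` (forward) / `F_μ⁻¹` (backward). For fundamental quarks on the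
't Hooft-twisted torus (Parisi; `N_f` a multiple of `N`) the boundary condition is
`ψ^a_α(n + L ν̂) = e^{iθ_ν} Ω_ν^{ab} ψ^b_β(n) (Ω_ν†)_{βα}`; once the colour twist matrices `Ω_ν` are
absorbed into the boundary links (`TwistedBoundaryConditions.lean`) only the flavour rotation
`F_ν = e^{iθ_ν} Ω̄_ν` survives, which must eat the conjugate twist (`F_μ F_ν = z̄_{μν} F_ν F_μ`) for
the field to be single valued. Common mass `m` and Wilson parameter `r`. [cite: LinOgawaRamos2015, §2.1] -/
def flavourTwistedWilsonDirac (U : GaugeConfig 4 L G) (m r : ℝ) :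
    Matrix (Fin Nf × (Site 4 L × Fin N × Fin 4)) (Fin Nf × (Site 4 L × Fin N × Fin 4)) ℂ :=
  Matrix.of fun p q =>
    (if p = q then ((m + 4 * r : ℝ) : ℂ) else 0) -
      (1 / 2 : ℂ) * ∑ μ : Fin 4,
        ((if q.2.1 = QuantumFieldTheory.Site.shift p.2.1 μ then
            flavourHop F p.2.1 μ p.1 q.1 *
              (((r : ℂ) • (1 : Matrix (Fin 4) (Fin 4) ℂ) - euclideanGamma μ) p.2.2.2 q.2.2.2 *
                ρ (U (p.2.1, μ)) p.2.2.1 q.2.2.1) else 0) +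
          (if p.2.1 = QuantumFieldTheory.Site.shift q.2.1 μ then
            flavourHopInv F q.2.1 μ p.1 q.1 *
              (((r : ℂ) • (1 : Matrix (Fin 4) (Fin 4) ℂ) + euclideanGamma μ) p.2.2.2 q.2.2.2 *
                ρ ((U (q.2.1, μ))⁻¹) p.2.2.1 q.2.2.1) else 0))

/-- With trivial flavour twist `F ≡ 1` the operator is the flavour-diagonal Wilson–Dirac operator
`1_{N_f} ⊗ D_W(U, m, r)` of the tree (`wilsonDirac`, as in `QCDOS.diracMatrix` at equal masses). [folklore] -/
theorem flavourTwistedWilsonDirac_one (U : GaugeConfig 4 L G) (m r : ℝ)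
    (p q : Fin Nf × (Site 4 L × Fin N × Fin 4)) :
    flavourTwistedWilsonDirac (fun _ => 1) ρ U m r p q =
      if p.1 = q.1 then wilsonDirac ρ U m r p.2 q.2 else 0 := by
  have hf : ∀ (x : Site 4 L) (μ : Fin 4), flavourHop (Nf := Nf) (fun _ => 1) x μ = 1 := fun x μ => by
    simp [flavourHop]
  have hb : ∀ (x : Site 4 L) (μ : Fin 4), flavourHopInv (Nf := Nf) (fun _ => 1) x μ = 1 := fun x μ => by
    simp [flavourHopInv]
  unfold flavourTwistedWilsonDirac wilsonDirac
  simp only [Matrix.of_apply, hf, hb, Matrix.one_apply, ite_mul, one_mul, zero_mul]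
  by_cases h : p.1 = q.1
  · simp only [h, if_true]
    congr 1
    by_cases hpq : p = q
    · subst hpq; simp
    · have : p.2 ≠ q.2 := fun h2 => hpq (Prod.ext h h2)
      simp [hpq, this]
  · have hpq : p ≠ q := fun h' => h (congrArg Prod.fst h')
    simp [h, hpq]

end FlavourTwist

end Literature.MathematicalPhysics.QuantumLattice
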